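import Mathlib
import Summits.KontsevichZagierPeriods.KontsevichZagierPeriods.Theorems.SoloInformedPellAbelBand
import Summits.KontsevichZagierPeriods.KontsevichZagierPeriods.Theorems.SoloInformedKummerZetaMoves
import Summits.KontsevichZagierPeriods.KontsevichZagierPeriods.Theorems.SoloInformedKummerInvolution
import HarnessLib
import HarnessLib.Audit

/-!
# Abel's theorem for the third kind inside `P`, III — the law (s41)

THEOREM XXX of the residency paper (§6quindecies), file III of three.  **For every Pell–Abel datum**
`P = (m, n, A, B, R, q₀, q₂)` (file I: `A² − B²Δ = R(1−nt²)`, `2(AB′−A′B)Δ + ABΔ′ = (q₀+q₂t²)R`,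
`A, R > 0` on `[−1,1]`, `B(0) = 0`, `q₂ + nq₀ ≠ 0`) the complete integral of the third kind is an
ALGEBRAIC multiple of the first, identically in the algebra of periods and for all representations:

  `⟦Π(n | m)⟧ = α·⟦K(m)⟧` in `P`,  `α = q₂/(q₂ + nq₀) ∈ ℚ̄`  (`soloInformed_pellAbel_law`).

The proof is two Newton–Leibniz moves on the algebraic 2-form `ψ = (q₀+q₂t²)Rκ/(A + (2u−1)BW)²`
over `(0,1)²` (files I–II): in `u` it deforms to `[(0,1), G]`, `G = (q₀+q₂t²)κ/(1−nt²) = dlog h/dt`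
(the norm identity), in `t` it is killed (`φ = 2BW/(A + (2u−1)BW)` vanishes at `t = 0, 1`); so
`⟦[(0,1), dlog h]⟧ = 0` — Abel's theorem — and rule (1b) with the split `κ/(1−nt²) = ακ + βG`
finishes.  No substitution move and no transcendental function enters.  Instances: the torsion
fibres of order four (`SoloInformedKummerTorsionFour`) and three (`SoloInformedKummerTorsionThree`).

References: N. H. Abel, *Sur l'intégration de la formule différentielle ρdx/√R …* (1826);
M. Kontsevich, D. Zagier, *Periods* (2001), §1.2; this work.
-/

noncomputable section

open MeasureTheory Set Filter
open scoped Classical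

open Literature.NumberTheory.Transcendental Literature.NumberTheory.Transcendental.KZ
open Literature.ModelTheory.ExponentialFields

namespace Summit.KontsevichZagierPeriods.KontsevichZagierPeriods.Theorems

namespace SoloInformedPellAbel

variable (P : SoloInformedPellAbel)

/-! ### The deformation: Newton–Leibniz in `u` over `(0,1) × [0,1]` -/

/-- **Deformation move.**  `[(0,1)², ψ(z₀, z₁)] ∼ [(0,1), Φ(x₀, 1)]` (rule 3 in `u`, `Φ(t,0) = 0`;
fibres opened by rule 1a). [cite: KontsevichZagier2001, §1.2] [this work] -/
theorem deformation :
    ∃ (r' : IntegralRep 2) (rd : IntegralRep 1),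
      r'.domain = {z : Fin 2 → ℝ | z 0 ∈ Ioo (0:ℝ) 1 ∧ z 1 ∈ Ioo (0:ℝ) 1} ∧
      (r'.integrand = fun z => P.psi (z 0) (z 1)) ∧
      rd.domain = {x : Fin 1 → ℝ | x 0 ∈ Ioo (0:ℝ) 1} ∧
      (rd.integrand = fun x => P.Phi (x 0) 1) ∧
      of r' - of rd ∈ relations := by
  have snoc0 : ∀ (x : Fin 1 → ℝ) (c : ℝ), (Fin.snoc x c : Fin 2 → ℝ) 0 = x 0 := fun _ _ => rfl
  have snoc1 : ∀ (x : Fin 1 → ℝ) (c : ℝ), (Fin.snoc x c : Fin 2 → ℝ) 1 = c := fun _ _ => rfl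
  have hl : (Fin.last 1 : Fin 2) = 1 := rfl
  have hB : IsSemialgebraic ℚ {y : Fin 1 → ℝ | y 0 ∈ Ioo (0:ℝ) 1} :=
    BallPeeling.isSemialgebraic_posIoo
  have hBm : MeasurableSet {y : Fin 1 → ℝ | y 0 ∈ Ioo (0:ℝ) 1} :=
    IsSemialgebraic.measurableSet_holds hB
  have h0sa : IsSemialgebraicFunOn ℚ {y : Fin 1 → ℝ | y 0 ∈ Ioo (0:ℝ) 1} (fun _ => (0:ℝ)) :=
    isSemialgebraicFunOn_const_of_isAlgebraic hB isAlgebraic_zero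
  have h1sa : IsSemialgebraicFunOn ℚ {y : Fin 1 → ℝ | y 0 ∈ Ioo (0:ℝ) 1} (fun _ => (1:ℝ)) :=
    isSemialgebraicFunOn_const_of_isAlgebraic hB isAlgebraic_one
  have hmem : ∀ u : Fin 2 → ℝ, u ∈ KZlog.band {y : Fin 1 → ℝ | y 0 ∈ Ioo (0:ℝ) 1}
      (fun _ => 0) (fun _ => 1) ↔ u 0 ∈ Ioo (0:ℝ) 1 ∧ 0 ≤ u 1 ∧ u 1 ≤ 1 := fun u => by
    simp only [KZlog.mem_band, mem_setOf_eq, Fin.init, Fin.castSucc_zero, hl]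
  have hband : IsSemialgebraic ℚ (KZlog.band {y : Fin 1 → ℝ | y 0 ∈ Ioo (0:ℝ) 1}
      (fun _ => 0) (fun _ => 1)) := KZlog.isSemialgebraic_band h0sa h1sa
  -- semialgebraicity and integrability on the closed band
  obtain ⟨hf, -, hF⟩ := P.sa_three hband 0 1
    (fun u hu => by rw [hmem] at hu; exact ⟨by linarith [hu.1.1], hu.1.2⟩)
    (fun u hu => by rw [hmem] at hu; exact ⟨hu.2.1, hu.2.2⟩)
  have hint := P.integrableOn_psi hband fun u hu => by
    rw [hmem] at hu; exact ⟨hu.1, hu.2.1, hu.2.2⟩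
  -- continuity and derivative along the fibres
  have hcont : ∀ x ∈ {y : Fin 1 → ℝ | y 0 ∈ Ioo (0:ℝ) 1},
      ContinuousOn (fun u : ℝ => (fun w : Fin 2 → ℝ => P.Phi (w 0) (w 1))
        (Fin.snoc x u)) (Icc ((fun _ : Fin 1 → ℝ => (0:ℝ)) x) ((fun _ : Fin 1 → ℝ => (1:ℝ)) x)) := by
    intro x hx
    have h : x 0 ∈ Ioo (0:ℝ) 1 := hx
    simp only [snoc0, snoc1]
    exact P.Phi_continuousOn (by nlinarith [h.1, h.2])
  have hder : ∀ x ∈ {y : Fin 1 → ℝ | y 0 ∈ Ioo (0:ℝ) 1},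
      ∀ u ∈ Ioo ((fun _ : Fin 1 → ℝ => (0:ℝ)) x) ((fun _ : Fin 1 → ℝ => (1:ℝ)) x),
      HasDerivAt (fun u : ℝ => (fun w : Fin 2 → ℝ => P.Phi (w 0) (w 1)) (Fin.snoc x u))
        ((fun w : Fin 2 → ℝ => P.psi (w 0) (w 1)) (Fin.snoc x u)) u := by
    intro x hx u hu
    have h : x 0 ∈ Ioo (0:ℝ) 1 := hx
    have hu' : 0 < u ∧ u < 1 := hu
    simp only [snoc0, snoc1]
    exact P.Phi_hasDerivAt (by nlinarith [h.1, h.2]) ⟨hu'.1.le, hu'.2.le⟩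
  -- the boundary function `Φ(t,1) − Φ(t,0) = Φ(t,1)` (`= G(t)` on `(0,1)`)
  have hφ : IsSemialgebraicMapOn ℚ {y : Fin 1 → ℝ | y 0 ∈ Ioo (0:ℝ) 1}
      (fun x => (Fin.snoc x 1 : Fin 2 → ℝ)) := by
    refine IsSemialgebraicMapOn.of_forall hB fun j => ?_
    induction j using Fin.lastCases with
    | last => simp only [Fin.snoc_last]; exact h1sa
    | cast i => simp only [Fin.snoc_castSucc]; exact isSemialgebraicFunOn_apply hB i
  have hmaps : MapsTo (fun x => (Fin.snoc x 1 : Fin 2 → ℝ)) {y : Fin 1 → ℝ | y 0 ∈ Ioo (0:ℝ) 1}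
      (KZlog.band {y : Fin 1 → ℝ | y 0 ∈ Ioo (0:ℝ) 1} (fun _ => 0) (fun _ => 1)) :=
    fun x hx => KZlog.snoc_mem_band.2 ⟨hx, zero_le_one, le_rfl⟩
  have hds : IsSemialgebraicFunOn ℚ {y : Fin 1 → ℝ | y 0 ∈ Ioo (0:ℝ) 1}
      (fun x => (fun w : Fin 2 → ℝ => P.Phi (w 0) (w 1))
          (Fin.snoc x ((fun _ : Fin 1 → ℝ => (1:ℝ)) x)) -
        (fun w : Fin 2 → ℝ => P.Phi (w 0) (w 1))
          (Fin.snoc x ((fun _ : Fin 1 → ℝ => (0:ℝ)) x))) := by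
    refine (hF.comp_isSemialgebraicMapOn_holds hφ hmaps).congr fun x _ => ?_
    simp only [Function.comp_apply, snoc0, snoc1, P.Phi_zero, sub_zero]
  have hsaG : IsSemialgebraicFunOn ℚ {y : Fin 1 → ℝ | y 0 ∈ Ioo (0:ℝ) 1}
      (fun x => P.G (x 0)) := by
    refine (hF.comp_isSemialgebraicMapOn_holds hφ hmaps).congr fun x hx => ?_
    have h : x 0 ∈ Ioo (0:ℝ) 1 := hx
    simp only [Function.comp_apply, snoc0, snoc1]
    exact P.Phi_one (by nlinarith [h.1, h.2])
  have hC := P.CG_nonneg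
  have hdiG : IntegrableOn (fun x : Fin 1 → ℝ => P.G (x 0)) {y : Fin 1 → ℝ | y 0 ∈ Ioo (0:ℝ) 1} := by
    refine soloInformed_integrableOn_of_le_inv_sqrt_prod hB hsaG ∅ {0} ∅ {0} P.CG ∅
      measure_empty (fun x hx _ j => ?_) (fun x _ hc => ?_)
    · have h : x 0 ∈ Ioo (0:ℝ) 1 := hx
      fin_cases j
      exact h
    · have ha := hc 0
      have hP := P.G_abs_le ⟨ha.1.le, ha.2⟩
      have hX : 0 ≤ (√(1 - x 0))⁻¹ := by positivity
      rw [Finset.prod_empty, Finset.prod_singleton, one_mul]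
      exact hP.trans (by nlinarith [mul_nonneg hC hX])
  have hdi : IntegrableOn
      (fun x => (fun w : Fin 2 → ℝ => P.Phi (w 0) (w 1))
          (Fin.snoc x ((fun _ : Fin 1 → ℝ => (1:ℝ)) x)) -
        (fun w : Fin 2 → ℝ => P.Phi (w 0) (w 1))
          (Fin.snoc x ((fun _ : Fin 1 → ℝ => (0:ℝ)) x)))
      {y : Fin 1 → ℝ | y 0 ∈ Ioo (0:ℝ) 1} := by
    refine hdiG.congr_fun (fun x hx => ?_) hBm
    have h : x 0 ∈ Ioo (0:ℝ) 1 := hx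
    simp only [snoc0, snoc1, P.Phi_zero, sub_zero]
    exact (P.Phi_one (by nlinarith [h.1, h.2])).symm
  -- Newton–Leibniz in `u`, then open the fibres
  obtain ⟨rb, rd, hrbd, hrbi, hrdd, hrdi, hrel⟩ := exists_band_newtonLeibniz hB
    (fun _ => (0:ℝ)) (fun _ => (1:ℝ)) h0sa h1sa (fun _ _ => zero_le_one) _ _ hF hf hcont hder
    hint hds hdi
  obtain ⟨r', hr'd, hr'i, hrel'⟩ := of_sub_of_restrict_openBand_mem_relations h0sa h1sa rb hrbd
  refine ⟨r', rd, ?_, by rw [hr'i, hrbi], hrdd, ?_, ?_⟩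
  · rw [hr'd]
    ext z
    simp only [mem_setOf_eq, Fin.init, Fin.castSucc_zero, hl, mem_Ioo]
  · rw [hrdi]
    funext x
    simp only [snoc0, snoc1, P.Phi_zero, sub_zero]
  · have h := relations.sub_mem hrel hrel'
    have e : of r' - of rd = of rb - of rd - (of rb - of r') := by abel
    rw [e]
    exact h

/-! ### The kill: Newton–Leibniz in `t` over `(0,1) × [0,1]`, coordinates swapped -/

/-- **Kill move** (Abel's theorem).  `[(0,1)², ψ(z₀, z₁)] ∼ 0`: `φ(0,u) = φ(1,u) = 0`.
[cite: KontsevichZagier2001, §1.2] [this work] -/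
theorem killed :
    ∃ T : IntegralRep 2, T.domain = {z : Fin 2 → ℝ | z 0 ∈ Ioo (0:ℝ) 1 ∧ z 1 ∈ Ioo (0:ℝ) 1} ∧
      (T.integrand = fun z => P.psi (z 0) (z 1)) ∧ of T ∈ relations := by
  have snoc0 : ∀ (x : Fin 1 → ℝ) (c : ℝ), (Fin.snoc x c : Fin 2 → ℝ) 0 = x 0 := fun _ _ => rfl
  have snoc1 : ∀ (x : Fin 1 → ℝ) (c : ℝ), (Fin.snoc x c : Fin 2 → ℝ) 1 = c := fun _ _ => rfl
  have hl : (Fin.last 1 : Fin 2) = 1 := rfl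
  have hB₂ : IsSemialgebraic ℚ {y : Fin 1 → ℝ | y 0 ∈ Ioo (0:ℝ) 1} :=
    BallPeeling.isSemialgebraic_posIoo
  have hmem : ∀ u : Fin 2 → ℝ, u ∈ KZlog.band {y : Fin 1 → ℝ | y 0 ∈ Ioo (0:ℝ) 1}
      (fun _ => 0) (fun _ => 1) ↔ u 0 ∈ Ioo (0:ℝ) 1 ∧ 0 ≤ u 1 ∧ u 1 ≤ 1 := fun u => by
    simp only [KZlog.mem_band, mem_setOf_eq, Fin.init, Fin.castSucc_zero, hl]
  have hband : IsSemialgebraic ℚ (KZlog.band {y : Fin 1 → ℝ | y 0 ∈ Ioo (0:ℝ) 1}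
      (fun _ => 0) (fun _ => 1)) :=
    KZlog.isSemialgebraic_band (isSemialgebraicFunOn_const_of_isAlgebraic hB₂ isAlgebraic_zero)
      (isSemialgebraicFunOn_const_of_isAlgebraic hB₂ isAlgebraic_one)
  obtain ⟨hg, hP⟩ := P.sa_swap_face hband fun u hu => by
    rw [hmem] at hu
    exact ⟨⟨by linarith [hu.2.1], hu.2.2⟩, ⟨hu.1.1.le, hu.1.2.le⟩⟩
  have hint := P.integrableOn_psi_swap hband fun u hu => by
    rw [hmem] at hu
    exact ⟨hu.1, hu.2.1, hu.2.2⟩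
  have hcont : ∀ y ∈ {y : Fin 1 → ℝ | y 0 ∈ Ioo (0:ℝ) 1},
      ContinuousOn (fun b : ℝ => (fun w : Fin 2 → ℝ => P.phi (w 1) (w 0)) (Fin.snoc y b))
        (Icc 0 1) := by
    intro y hy
    have h : y 0 ∈ Ioo (0:ℝ) 1 := hy
    simp only [snoc0, snoc1]
    exact P.phi_continuousOn ⟨h.1.le, h.2.le⟩
  have hder : ∀ y ∈ {y : Fin 1 → ℝ | y 0 ∈ Ioo (0:ℝ) 1}, ∀ b ∈ Ioo (0:ℝ) 1,
      HasDerivAt (fun b : ℝ => (fun w : Fin 2 → ℝ => P.phi (w 1) (w 0)) (Fin.snoc y b))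
        ((fun w : Fin 2 → ℝ => P.psi (w 1) (w 0)) (Fin.snoc y b)) b := by
    intro y hy b hb
    have h : y 0 ∈ Ioo (0:ℝ) 1 := hy
    have hb2 : b ^ 2 < 1 := by nlinarith [hb.1, hb.2]
    simp only [snoc0, snoc1]
    exact P.phi_hasDerivAt hb2 ⟨h.1.le, h.2.le⟩
  have h0 : ∀ y ∈ {y : Fin 1 → ℝ | y 0 ∈ Ioo (0:ℝ) 1},
      (fun w : Fin 2 → ℝ => P.phi (w 1) (w 0)) (Fin.snoc y 1) -
        (fun w : Fin 2 → ℝ => P.phi (w 1) (w 0)) (Fin.snoc y 0) = 0 := by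
    intro y _
    simp only [snoc0, snoc1, P.phi_left, P.phi_right, sub_zero]
  have he0 : Equiv.swap (0 : Fin 2) 1 0 = 1 := by decide
  have he1 : Equiv.swap (0 : Fin 2) 1 1 = 0 := by decide
  obtain ⟨T, hTd, hTi, hT⟩ := soloInformed_kummerZeta_kill _ hB₂ _ _ hP hg hcont hder hint h0
    (Equiv.swap 0 1)
  refine ⟨T, ?_, ?_, hT⟩
  · rw [hTd]
    ext w
    simp only [mem_setOf_eq, Fin.init, Fin.castSucc_zero, hl, he0, he1, mem_Ioo]
    constructor
    · rintro ⟨h1, h2, h3⟩; exact ⟨⟨h2, h3⟩, h1⟩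
    · rintro ⟨⟨h2, h3⟩, h1⟩; exact ⟨h1, h2, h3⟩
  · rw [hTi]
    funext w
    simp only [he0, he1]

/-- **Abel's theorem in `P`**: `⟦[(0,1), dlog h/dt]⟧ = 0`, i.e. any representation of
`∫₀¹ (q₀+q₂t²)κ dt/(1−nt²)` on `(0,1)` with integrand `Φ(·,1)` is a relation. [this work] -/
theorem dlog_mem_relations :
    ∃ rd : IntegralRep 1, rd.domain = {x : Fin 1 → ℝ | x 0 ∈ Ioo (0:ℝ) 1} ∧
      (rd.integrand = fun x => P.Phi (x 0) 1) ∧ of rd ∈ relations := by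
  obtain ⟨r', rd, hr'd, hr'i, hrdd, hrdi, hdef⟩ := P.deformation
  obtain ⟨T, hTd, hTi, hT⟩ := P.killed
  have hrT : of r' - of T ∈ relations :=
    of_sub_of_mem_relations_of_eqOn (by rw [hTd, hr'd]) fun z _ => by rw [hr'i, hTi]
  have hr' : of r' ∈ relations := by
    have h := relations.add_mem hrT hT
    simpa using h
  refine ⟨rd, hrdd, hrdi, ?_⟩
  have h := relations.sub_mem hr' hdef
  simpa using h

end SoloInformedPellAbel

/-! ### THEOREM XXX -/


/-- **THEOREM XXX (Abel's theorem for the third kind, in `P`).**  For every Pell–Abel datum `P`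
and ALL representations `Π_n = [(0,1), κ_m/(1−nx²)]`, `K = [(0,1), κ_m]`:
`⟦Π_n⟧ = ⟦[pt, α]⟧·⟦K⟧` in `P`, `α = q₂/(q₂ + nq₀)`. [this work] -/
theorem soloInformed_pellAbel_law (P : SoloInformedPellAbel) (PN K : IntegralRep 1)
    (hPNd : PN.domain = {x | x 0 ∈ Ioo (0:ℝ) 1})
    (hPNi : EqOn PN.integrand (fun x => (1 - P.n * x 0 ^ 2)⁻¹ *
      ((√(1 - x 0 ^ 2))⁻¹ * (√(1 - P.m * x 0 ^ 2))⁻¹)) PN.domain)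
    (hKd : K.domain = {x | x 0 ∈ Ioo (0:ℝ) 1})
    (hKi : EqOn K.integrand (fun x => (√(1 - x 0 ^ 2))⁻¹ * (√(1 - P.m * x 0 ^ 2))⁻¹) K.domain) :
    toFormalPeriod (of PN) =
      toFormalPeriod (of (IntegralRep.unit.constMul P.alpha P.alpha_beta_isAlgebraic.1)) *
        toFormalPeriod (of K) := by
  have hα := P.alpha_beta_isAlgebraic.1
  have hβ := P.alpha_beta_isAlgebraic.2
  have hn := P.n_mem
  obtain ⟨rd, hrdd, hrdi, hrd⟩ := P.dlog_mem_relations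
  -- rule 1b with the split `κ/(1−nt²) = ακ + βΦ(·,1)` on `(0,1)`
  have hrel : of PN - of (K.constMul _ hα) - of (rd.constMul _ hβ) ∈ relations := by
    refine integrandAddRel_subset_relations ⟨1, PN, K.constMul _ hα, rd.constMul _ hβ,
      by rw [IntegralRep.domain_constMul, hKd, hPNd], by rw [IntegralRep.domain_constMul, hrdd, hPNd],
      fun x hx => ?_, rfl⟩
    have hxK : x ∈ K.domain := by rw [hKd, ← hPNd]; exact hx
    have hx' : x 0 ∈ Ioo (0:ℝ) 1 := by rw [hPNd] at hx; exact hx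
    have ht2 : x 0 ^ 2 < 1 := by nlinarith [hx'.1, hx'.2]
    have hD : 1 - P.n * x 0 ^ 2 ≠ 0 := by nlinarith [hn.1, hn.2, ht2]
    simp only [Pi.add_apply, IntegralRep.integrand_constMul, hrdi, hPNi hx, hKi hxK,
      P.Phi_one ht2, SoloInformedPellAbel.G]
    rw [P.alpha_eq hD]
    field_simp
    ring
  -- assemble in `P`
  have t1 : toFormalPeriod (of PN) - toFormalPeriod (of (K.constMul _ hα)) =
      toFormalPeriod (of (rd.constMul _ hβ)) := by
    rw [← map_sub]
    exact toFormalPeriod_eq_iff.mpr hrel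
  have t2 : toFormalPeriod (of rd) = 0 := by
    have h := toFormalPeriod_eq_iff.mpr (show of rd - 0 ∈ relations by simpa using hrd)
    simpa using h
  rw [sub_eq_iff_eq_add.mp t1, toFormalPeriod_of_constMul _ hβ rd, t2, mul_zero, zero_add,
    toFormalPeriod_of_constMul]

/-- **THEOREM XXX in values**: `Π(n | m) = α·K(m)`. [this work] -/
theorem soloInformed_pellAbel_law_value (P : SoloInformedPellAbel) (PN K : IntegralRep 1)
    (hPNd : PN.domain = {x | x 0 ∈ Ioo (0:ℝ) 1})
    (hPNi : EqOn PN.integrand (fun x => (1 - P.n * x 0 ^ 2)⁻¹ *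
      ((√(1 - x 0 ^ 2))⁻¹ * (√(1 - P.m * x 0 ^ 2))⁻¹)) PN.domain)
    (hKd : K.domain = {x | x 0 ∈ Ioo (0:ℝ) 1})
    (hKi : EqOn K.integrand (fun x => (√(1 - x 0 ^ 2))⁻¹ * (√(1 - P.m * x 0 ^ 2))⁻¹) K.domain) :
    PN.value = P.alpha * K.value := by
  have h := congrArg evalP (soloInformed_pellAbel_law P PN K hPNd hPNi hKd hKi)
  simpa only [map_mul, evalP_toFormalPeriod_of, IntegralRep.value_constMul,
    IntegralRep.value_unit, mul_one] using h

/-- **The two representations exist**, and satisfy the law. [this work] -/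
theorem soloInformed_pellAbel_law_exists (P : SoloInformedPellAbel) :
    ∃ PN K : IntegralRep 1,
      PN.domain = {x | x 0 ∈ Ioo (0:ℝ) 1} ∧
      (∀ x, PN.integrand x = (1 - P.n * x 0 ^ 2)⁻¹ *
        ((√(1 - x 0 ^ 2))⁻¹ * (√(1 - P.m * x 0 ^ 2))⁻¹)) ∧
      K.domain = {x | x 0 ∈ Ioo (0:ℝ) 1} ∧
      (∀ x, K.integrand x = (√(1 - x 0 ^ 2))⁻¹ * (√(1 - P.m * x 0 ^ 2))⁻¹) ∧
      PN.value = P.alpha * K.value := by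
  have hm := P.m_mem
  have hn := P.n_mem
  obtain ⟨PN, hPNd, hPNi⟩ := soloInformed_exists_ellipticPi_rep_of_lt_one _ _ hn.2 P.n_isAlgebraic
    hm P.m_isAlgebraic
  obtain ⟨K, hKd, hKi⟩ := soloInformed_exists_ellipticK_rep _ hm P.m_isAlgebraic
  exact ⟨PN, K, hPNd, hPNi, hKd, hKi, soloInformed_pellAbel_law_value P PN K hPNd
    (fun x _ => hPNi x) hKd (fun x _ => hKi x)⟩

end Summit.KontsevichZagierPeriods.KontsevichZagierPeriods.Theorems

end
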